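import Summits.QuantumFields.YangMills.Theorems.PoincareLipschitzHistoryTailOfGap
import Summits.QuantumFields.YangMills.Theorems.PoincareLipschitzGapOfHSystemGap
import Summits.QuantumFields.YangMills.Theorems.PoincareLipschitzHSystemGapAtThreePiOfDoors
import Summits.QuantumFields.YangMills.Theorems.PoincareLipschitzWenteTwoPointOfRows
import Summits.QuantumFields.YangMills.Theorems.PoincareLipschitzWenteOneCentre
import Summits.QuantumFields.YangMills.Theorems.PoincareLipschitzSobolevInversionWente
import Summits.QuantumFields.YangMills.Theorems.PoincareLipschitzSobolevPlanarDecay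
import HarnessLib

/-!
# Crux `BlockLipschitzL` (stmt-QuantumFields-23533, route PoincareLipschitz, K2 of rung R3) — THE CLOSE

Cell `ym3-torus` (YM ladder rung R3 = continuum SU(2) Yang–Mills on T³ — a RUNG, NOT the Clay problem: not d = 4, not infinite volume, not a mass gap);
LEAD seat `ym-ust-19936-w1` g10.  ONE application by landed names: ✓K-15 p733775 `PoincareLipschitzHistoryTailOfGap.blockLipschitzL_of_gap (hGap) : BlockLipschitzL`
(the K2 organ: LINE 25 Γ1 ✓p718508 ⊕ S2♭″ ✓p724606 ⊕ the organ K-8a ⊕ ★w3's cap H ⊕ K-5∕K-4b∕K-3, over ★px3 g9's hypothesis-free central density cap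
✓p731550 `uniformSmallScaleEnergy_band_of_gap`) at `hGap :=` THE 8π ENERGY GAP OF MINIMIZING TANGENT MAPS `ℝ³ → S³`, ASSEMBLED INLINE FROM LANDED NAMES ONLY (the same term ★px19 g8 names
`PoincareLipschitzGapHolds.gap_holds` (W2) over ★w3 g16's `PoincareLipschitzHSystemGapAtThreePi.{doorTWO_holds, hSystem_energy_zero_of_le_three_pi}` — both in the
gate's olean-lag queue at filing time; this file inlines their two `exact` terms so that the crux close waits on no pending proposal, D-0071):
`gap_of_hSystemGap` (★px19 g8 ✓p737233, ROAD (H): SU(2) currents ⇒ H-system, cone chart px14 g7 ∕ px16 g10 ∕ px19, planar stream functions px5 g9 H6–H8,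
px3 g9 `Θ ≤ 3π` + the central density cap ✓p731550) fed with the HYPOTHESIS-FREE H-SYSTEM ENERGY GAP AT 3π = ★w3 g16's ✓p735014
`…HSystemGapAtThreePiOfDoors.hSystem_energy_zero_of_le_three_pi_of_doorTWO` at the SHARP TWO-POINT WENTE BOUND `…WenteTwoPointOfRows.doorTWO_of_rows` (★w3 g16 ✓p735457)
of w7 g15's ✓`…WenteOneCentre.wente_oneCentre`, w4 g16's ✓`…SobolevInversion.wenteTriple_comp_inversion`, px22 g8's ✓`…SobolevPlanarDecay.integrableOn_sq_div_norm_pow_four`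
(ROAD (W); also px6 g10 W-WIR `…CircleWirtinger`, px3 g10 W-EN, px22 W-TWO).  LINE 25 underneath: px3 Γ-KNIT ∕ S2♭″ ✓p724606, w3 Γ1 ✓p718508 + S1″-RED ∕ KNIT, w8 Γ2-W,
this seat Γ2-IBP ✓p720162 + the organ K-8a ✓p721149 + K-15 ✓p733775.  NO named Literature fact and NO hypothesis remains.  The TYPE is literally the route decl
`Summit.QuantumFields.YangMills.Theses.PoincareLipschitz.BlockLipschitzL`.

WHAT THIS IS: the deterministic K2 statement of route PoincareLipschitz — for locally hierarchically small pairs of fields, the level-`j` averaged plaquette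
deviation is `CL∕√(L^j)`-Lipschitz in the box-restricted link metric — PROVED UNCONDITIONALLY (axioms ⊆ {propext, Classical.choice, Quot.sound}).
WHAT THIS IS NOT: not `HistoryTailL` (19936; its K2-lane face still carries K1-exp and the first-moment row), not K1 (23532), not `MeanDeviationL` (23083), not
the rung `YM3TorusSU2`, not d = 4, not infinite volume, not a mass gap, not Clay; the YM gap is NOT proved.
-/

set_option autoImplicit false

namespace Summit.QuantumFields.YangMills.Theorems.PoincareLipschitzBlockLipschitzL

open Summit.QuantumFields.YangMills.Theorems

/-- ★★★★ **THE K2 CRUX `BlockLipschitzL` (stmt-QuantumFields-23533) — PROVED.** [cite: Balaban1985Averaging, Prop. 1; SchoenUhlenbeck1984, Lemma 1.1; Luckhaus1988, Thm 2] -/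
theorem blockLipschitzL_proof : Summit.QuantumFields.YangMills.Theses.PoincareLipschitz.BlockLipschitzL :=
  PoincareLipschitzHistoryTailOfGap.blockLipschitzL_of_gap
    (PoincareLipschitzGapOfHSystemGap.gap_of_hSystemGap fun _ _ hB hB2 hE hH hΘ =>
      PoincareLipschitzHSystemGapAtThreePiOfDoors.hSystem_energy_zero_of_le_three_pi_of_doorTWO
        (PoincareLipschitzWenteTwoPointOfRows.doorTWO_of_rows
          PoincareLipschitzWenteOneCentre.wente_oneCentre
          (fun c _ _ _ _ _ _ hu ha hb hu2 ha2 hb2 hGu hGa hGb hEq hdu hda hdb =>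
            PoincareLipschitzSobolevInversion.wenteTriple_comp_inversion c hu ha hb hu2 ha2 hb2 hGu hGa hGb hEq hdu hda hdb)
          (fun hv hv2 hGv c => PoincareLipschitzSobolevPlanarDecay.integrableOn_sq_div_norm_pow_four hv hv2 hGv c))
        hB hB2 hE hH hΘ)

end Summit.QuantumFields.YangMills.Theorems.PoincareLipschitzBlockLipschitzL
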